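import Literature.Topology.FourManifolds.BordismProofs
import HarnessLib

/-!
# Triple disjoint unions of manifolds: summand permutations, components, gluing, boundary

Topic `Literature/Topology/FourManifolds`.  Everything here is PROVED; no named facts.

Plumbing over Mathlib's disjoint-union manifolds (`ChartedSpace.sum`, `IsManifold.disjointUnion`,
`ContMDiff.sumElim`, `ContMDiff.inl` / `ContMDiff.inr`, `contMDiff_of_contMDiff_inl` / `_inr`,
`Diffeomorph.sumCongr`, `ModelWithCorners.boundary_disjointUnion`) and the tree's
`Manifold.IsSmoothEmbedding.sumMap` (`BordismProofs.lean`), for the iterated sum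
`TriSum W = W 0 ⊕ (W 1 ⊕ W 2)` of a `Fin 3`-indexed family of manifolds — the shape in which a
`4`-manifold split along a regular level into a piece and THREE handlebodies presents its second
piece (Abrams–Gay–Kirby, *Group trisections and smooth 4-manifolds*, Geom. Topol. 22 (2018), proof
of Thm. 5: the three sectors of a trisection are recovered from the spine as `1`-handlebody
fillings; consumer: the `AgkCor6Sufficiency` crux files under `Summits/SmoothPoincare4`).

* `TriSum.inj`, `TriSum.idx` — the summand inclusions and the index map; a map out of a triple
  sum is `C^n` iff it is so on each summand (`contMDiff_of_comp_inj`), a map into a summand is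
  `C^n` iff its composite with the inclusion is (`contMDiff_of_inj_comp`).
* `TriSum.exists_perm` — **a homeomorphism between triple disjoint unions of connected spaces
  permutes the summands** (the index map is continuous into the discrete `Fin 3`, hence constant
  on connected summands; components of a manifold are open — Lee, *Introduction to Smooth
  Manifolds* (2013), Ch. 1).
* `TriSum.comp` — the summand components `W i ≅ W' (σ i)` of a summand-respecting `C^n`
  diffeomorphism (smooth by Mathlib's `contMDiff_of_contMDiff_inl/inr`).
* `TriSum.glue` — **gluing summand-wise diffeomorphisms** `Ψ i : W i ≅ W' (σ i)` along a
  permutation `σ` to a diffeomorphism of the triple sums (Mathlib's `Diffeomorph.sumCongr` is the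
  case `σ = 1` of binary sums).
* `TriSum.boundaryData` — **the boundary of a disjoint union is the disjoint union of the
  boundaries**, as a `BoundaryData` (`Cobordism.lean`) of the triple sum assembled from boundary
  data of the summands (triple version of `Cobordism.boundaryDataSum`,
  `CobordismBoundaryData.lean`).

## References

* J. M. Lee, *Introduction to Smooth Manifolds*, 2nd ed., GTM 218 (2013), Ch. 1 (disjoint unions
  of manifolds; components of a manifold are open). [LeeSmoothManifolds2013]
* M. W. Hirsch, *Differential Topology*, GTM 33 (1976), Ch. 1 §1–2 (manifolds with boundary,
  `∂` of a disjoint union). [HirschDT1976]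
-/

open scoped Manifold ContDiff Topology
open Set Function

noncomputable section

namespace Literature.Topology.FourManifolds

universe u

/-! ### Triple disjoint unions `W 0 ⊔ W 1 ⊔ W 2` -/

/-- The triple disjoint union `W 0 ⊔ W 1 ⊔ W 2` of a `Fin 3`-indexed family, as the iterated
binary sum `W 0 ⊕ (W 1 ⊕ W 2)` (so that Mathlib's charted-space and `C^n`-manifold structures on
binary disjoint unions, `ChartedSpace.sum` and `IsManifold.disjointUnion`, apply). [folklore] -/
abbrev TriSum (W : Fin 3 → Type u) : Type u := W 0 ⊕ (W 1 ⊕ W 2)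

namespace TriSum

variable (W : Fin 3 → Type u)

/-- The inclusion `W i → W 0 ⊔ W 1 ⊔ W 2` of the `i`-th summand. [folklore] -/
def inj : (i : Fin 3) → W i → TriSum W
  | 0 => Sum.inl
  | 1 => fun w => Sum.inr (Sum.inl w)
  | 2 => fun w => Sum.inr (Sum.inr w)

/-- The summand index of a point of `W 0 ⊔ W 1 ⊔ W 2`. [folklore] -/
def idx : TriSum W → Fin 3 := Sum.elim (fun _ => 0) (Sum.elim (fun _ => 1) (fun _ => 2))

/-- Points of the `i`-th summand have index `i`. [folklore] -/
@[simp] theorem idx_inj (i : Fin 3) (w : W i) : idx W (inj W i w) = i := by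
  match i with
  | 0 => rfl
  | 1 => rfl
  | 2 => rfl

/-- Every point lies in the summand of its index. [folklore] -/
theorem exists_eq_inj (x : TriSum W) : ∃ w : W (idx W x), x = inj W (idx W x) w := by
  rcases x with a | b | c
  exacts [⟨a, rfl⟩, ⟨b, rfl⟩, ⟨c, rfl⟩]

/-- Every point lies in some summand. [folklore] -/
theorem exists_eq_inj' (x : TriSum W) : ∃ (i : Fin 3) (w : W i), x = inj W i w :=
  ⟨idx W x, exists_eq_inj W x⟩

/-- A point of index `k` lies in the `k`-th summand. [folklore] -/
theorem exists_inj_eq_of_idx_eq (x : TriSum W) {k : Fin 3} (hk : idx W x = k) :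
    ∃ w : W k, inj W k w = x := by
  subst hk
  obtain ⟨w, hw⟩ := exists_eq_inj W x
  exact ⟨w, hw.symm⟩

/-- The summand inclusions are injective. [folklore] -/
theorem inj_injective (i : Fin 3) : Injective (inj W i) := by
  match i with
  | 0 => exact Sum.inl_injective
  | 1 => exact Sum.inr_injective.comp Sum.inl_injective
  | 2 => exact Sum.inr_injective.comp Sum.inr_injective

/-- Distinct summands are disjoint. [folklore] -/
theorem idx_eq_of_inj_eq {i j : Fin 3} {w : W i} {w' : W j} (h : inj W i w = inj W j w') :
    i = j := by
  rw [← idx_inj W i w, h, idx_inj]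

section Topology

variable [∀ i, TopologicalSpace (W i)]

/-- The index map is continuous (locally constant: the summands are clopen). [folklore] -/
theorem continuous_idx : Continuous (idx W) :=
  continuous_const.sumElim (continuous_const.sumElim continuous_const)

/-- The summand inclusions are continuous. [folklore] -/
theorem continuous_inj (i : Fin 3) : Continuous (inj W i) := by
  match i with
  | 0 => exact continuous_inl
  | 1 => exact continuous_inr.comp continuous_inl
  | 2 => exact continuous_inr.comp continuous_inr

end Topology

section Smooth

variable {E H : Type*} [NormedAddCommGroup E] [NormedSpace ℝ E] [TopologicalSpace H]
  {I : ModelWithCorners ℝ E H} {n : WithTop ℕ∞}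
  [∀ i, TopologicalSpace (W i)] [∀ i, ChartedSpace H (W i)]
  {E' H' : Type*} [NormedAddCommGroup E'] [NormedSpace ℝ E'] [TopologicalSpace H']
  {J : ModelWithCorners ℝ E' H'} {N : Type*} [TopologicalSpace N] [ChartedSpace H' N]

/-- The summand inclusions are `C^n` (Mathlib's `ContMDiff.inl`, `ContMDiff.inr`). [folklore] -/
theorem contMDiff_inj (i : Fin 3) : ContMDiff I I n (inj W i) := by
  match i with
  | 0 => exact ContMDiff.inl
  | 1 => exact ContMDiff.inr.comp ContMDiff.inl
  | 2 => exact ContMDiff.inr.comp ContMDiff.inr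

/-- A map out of `W 0 ⊔ W 1 ⊔ W 2` is `C^n` as soon as it is `C^n` on each summand (Mathlib's
`ContMDiff.sumElim`). [folklore] -/
theorem contMDiff_of_comp_inj {g : TriSum W → N} (h : ∀ i, ContMDiff I J n (g ∘ inj W i)) :
    ContMDiff I J n g := by
  have hg : g =
      Sum.elim (g ∘ Sum.inl) (Sum.elim (g ∘ Sum.inr ∘ Sum.inl) (g ∘ Sum.inr ∘ Sum.inr)) := by
    ext x; rcases x with a | b | c <;> rfl
  rw [hg]
  exact (h 0).sumElim ((h 1).sumElim (h 2))

/-- A map into the `j`-th summand is `C^n` as soon as its composite with the summand inclusion is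
(Mathlib's `contMDiff_of_contMDiff_inl`, `contMDiff_of_contMDiff_inr`). [folklore] -/
theorem contMDiff_of_inj_comp {j : Fin 3} {g : N → W j} (h : ContMDiff J I n (inj W j ∘ g)) :
    ContMDiff J I n g := by
  match j, g, h with
  | 0, _, h => exact contMDiff_of_contMDiff_inl h
  | 1, g, h => exact contMDiff_of_contMDiff_inl (contMDiff_of_contMDiff_inr (g := Sum.inl ∘ g) h)
  | 2, g, h => exact contMDiff_of_contMDiff_inr (contMDiff_of_contMDiff_inr (g := Sum.inr ∘ g) h)

end Smooth

/-! #### The permutation of summands induced by a homeomorphism of triple sums -/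

section Perm

variable {W} (W' : Fin 3 → Type u) [∀ i, TopologicalSpace (W i)] [∀ i, TopologicalSpace (W' i)]

omit [∀ i, TopologicalSpace (W i)] [∀ i, TopologicalSpace (W' i)] in
/-- If a bijection `χ` of triple sums carries the `i`-th summand into the `s i`-th one and `χ⁻¹`
carries the `j`-th summand into the `t j`-th one, then `t ∘ s = id` on nonempty summands.
[folklore] -/
theorem perm_aux (χ : TriSum W ≃ TriSum W') (s t : Fin 3 → Fin 3)
    (hs : ∀ i w, idx W' (χ (inj W i w)) = s i) (ht : ∀ j w', idx W (χ.symm (inj W' j w')) = t j)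
    (i : Fin 3) (w₀ : W i) : t (s i) = i := by
  obtain ⟨w', hw'⟩ := exists_eq_inj W' (χ (inj W i w₀))
  have h1 := ht _ w'
  rw [← hw', Equiv.symm_apply_apply, idx_inj, hs] at h1
  exact h1.symm

/-- **A homeomorphism between triple disjoint unions of (nonempty) connected spaces permutes the
summands**: there is a permutation `σ` of the indices such that the `i`-th summand is carried
into the `σ i`-th one (the continuous index map is constant on the connected summands,
`PreconnectedSpace.constant`). [folklore] -/
theorem exists_perm [∀ i, ConnectedSpace (W i)] [∀ i, ConnectedSpace (W' i)]
    (χ : TriSum W ≃ₜ TriSum W') :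
    ∃ σ : Equiv.Perm (Fin 3), ∀ i w, idx W' (χ (inj W i w)) = σ i := by
  set s : Fin 3 → Fin 3 := fun i => idx W' (χ (inj W i (Classical.arbitrary _))) with hs_def
  set t : Fin 3 → Fin 3 := fun j => idx W (χ.symm (inj W' j (Classical.arbitrary _))) with ht_def
  have hs : ∀ i w, idx W' (χ (inj W i w)) = s i := fun i w =>
    PreconnectedSpace.constant inferInstance
      ((continuous_idx W').comp (χ.continuous.comp (continuous_inj W i)))
  have ht : ∀ j w', idx W (χ.symm (inj W' j w')) = t j := fun j w' =>
    PreconnectedSpace.constant inferInstance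
      ((continuous_idx W).comp (χ.symm.continuous.comp (continuous_inj W' j)))
  refine ⟨⟨s, t, fun i => ?_, fun j => ?_⟩, hs⟩
  · exact perm_aux W' χ.toEquiv s t hs ht i (Classical.arbitrary _)
  · exact perm_aux W χ.toEquiv.symm t s ht hs j (Classical.arbitrary _)

end Perm

/-! #### The summand components of a summand-respecting diffeomorphism -/

section Components

variable {W} {W' : Fin 3 → Type u} {E H : Type*} [NormedAddCommGroup E] [NormedSpace ℝ E]
  [TopologicalSpace H] {I : ModelWithCorners ℝ E H} {n : WithTop ℕ∞}
  [∀ i, TopologicalSpace (W i)] [∀ i, ChartedSpace H (W i)]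
  [∀ i, TopologicalSpace (W' i)] [∀ i, ChartedSpace H (W' i)]
  (χ : TriSum W ≃ₘ^n⟮I, I⟯ TriSum W') (σ : Equiv.Perm (Fin 3))
  (hσ : ∀ i w, idx W' (χ (inj W i w)) = σ i)

include hσ

/-- If `χ` carries the `i`-th summand into the `σ i`-th one (`σ` a permutation), then `χ⁻¹`
carries the `σ i`-th summand into the `i`-th one. [folklore] -/
theorem idx_symm_inj (i : Fin 3) (w' : W' (σ i)) : idx W (χ.symm (inj W' (σ i) w')) = i := by
  obtain ⟨w, hw⟩ := exists_eq_inj W (χ.symm (inj W' (σ i) w'))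
  have h1 := hσ _ w
  rw [← hw, Diffeomorph.apply_symm_apply, idx_inj] at h1
  exact (σ.injective h1).symm

/-- The `i`-th component `W i → W' (σ i)` of `χ` (as a function). [folklore] -/
def compFun (i : Fin 3) : W i → W' (σ i) := fun w =>
  Classical.choose (exists_inj_eq_of_idx_eq W' (χ (inj W i w)) (hσ i w))

/-- Defining equation of `compFun`: `inj (σ i) ∘ compFun i = χ ∘ inj i`. [folklore] -/
theorem inj_compFun (i : Fin 3) (w : W i) : inj W' (σ i) (compFun χ σ hσ i w) = χ (inj W i w) :=
  Classical.choose_spec (exists_inj_eq_of_idx_eq W' (χ (inj W i w)) (hσ i w))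

/-- The `i`-th component `W' (σ i) → W i` of `χ⁻¹` (as a function). [folklore] -/
def compInv (i : Fin 3) : W' (σ i) → W i := fun w' =>
  Classical.choose (exists_inj_eq_of_idx_eq W (χ.symm (inj W' (σ i) w')) (idx_symm_inj χ σ hσ i w'))

/-- Defining equation of `compInv`: `inj i ∘ compInv i = χ⁻¹ ∘ inj (σ i)`. [folklore] -/
theorem inj_compInv (i : Fin 3) (w' : W' (σ i)) :
    inj W i (compInv χ σ hσ i w') = χ.symm (inj W' (σ i) w') :=
  Classical.choose_spec
    (exists_inj_eq_of_idx_eq W (χ.symm (inj W' (σ i) w')) (idx_symm_inj χ σ hσ i w'))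

/-- **The `i`-th component of a summand-respecting `C^n` diffeomorphism of triple sums**: the
`C^n` diffeomorphism `W i ≅ W' (σ i)` with `inj (σ i) ∘ comp i = χ ∘ inj i` (smoothness of the
components from that of `χ`, `χ⁻¹` by `contMDiff_of_inj_comp`). [folklore] -/
def comp (i : Fin 3) : W i ≃ₘ^n⟮I, I⟯ W' (σ i) where
  toFun := compFun χ σ hσ i
  invFun := compInv χ σ hσ i
  left_inv w := by
    apply inj_injective W i
    rw [inj_compInv, inj_compFun, Diffeomorph.symm_apply_apply]
  right_inv w' := by
    apply inj_injective W' (σ i)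
    rw [inj_compFun, inj_compInv, Diffeomorph.apply_symm_apply]
  contMDiff_toFun := by
    refine contMDiff_of_inj_comp W' (j := σ i) ?_
    have h : inj W' (σ i) ∘ compFun χ σ hσ i = χ ∘ inj W i := funext fun w => inj_compFun χ σ hσ i w
    change ContMDiff I I n (inj W' (σ i) ∘ compFun χ σ hσ i)
    rw [h]
    exact χ.contMDiff.comp (contMDiff_inj W i)
  contMDiff_invFun := by
    refine contMDiff_of_inj_comp W (j := i) ?_
    have h : inj W i ∘ compInv χ σ hσ i = χ.symm ∘ inj W' (σ i) :=
      funext fun w' => inj_compInv χ σ hσ i w'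
    change ContMDiff I I n (inj W i ∘ compInv χ σ hσ i)
    rw [h]
    exact χ.symm.contMDiff.comp (contMDiff_inj W' (σ i))

/-- Defining equation of `comp`: `inj (σ i) ∘ comp i = χ ∘ inj i`. [folklore] -/
@[simp]
theorem inj_comp_apply (i : Fin 3) (w : W i) : inj W' (σ i) (comp χ σ hσ i w) = χ (inj W i w) :=
  inj_compFun χ σ hσ i w

end Components

/-! #### Gluing summand-wise diffeomorphisms along a permutation -/

section Glue

variable {W} {W' : Fin 3 → Type u} {E H : Type*} [NormedAddCommGroup E] [NormedSpace ℝ E]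
  [TopologicalSpace H] {I : ModelWithCorners ℝ E H} {n : WithTop ℕ∞}
  [∀ i, TopologicalSpace (W i)] [∀ i, ChartedSpace H (W i)]
  [∀ i, TopologicalSpace (W' i)] [∀ i, ChartedSpace H (W' i)]
  (σ : Equiv.Perm (Fin 3)) (Ψ : ∀ i, W i ≃ₘ^n⟮I, I⟯ W' (σ i))

/-- The map `W 0 ⊔ W 1 ⊔ W 2 → W' 0 ⊔ W' 1 ⊔ W' 2` which is `Ψ i : W i ≅ W' (σ i)` on the `i`-th
summand. [folklore] -/
def glueFun : TriSum W → TriSum W' :=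
  Sum.elim (inj W' (σ 0) ∘ Ψ 0) (Sum.elim (inj W' (σ 1) ∘ Ψ 1) (inj W' (σ 2) ∘ Ψ 2))

/-- `glueFun` on the `i`-th summand is `inj (σ i) ∘ Ψ i`. [folklore] -/
@[simp]
theorem glueFun_inj (i : Fin 3) (w : W i) : glueFun σ Ψ (inj W i w) = inj W' (σ i) (Ψ i w) := by
  match i with
  | 0 => rfl
  | 1 => rfl
  | 2 => rfl

/-- `glueFun` is a bijection (`σ` is a permutation and each `Ψ i` is a bijection). [folklore] -/
theorem glueFun_bijective : Bijective (glueFun σ Ψ) := by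
  constructor
  · intro x y h
    obtain ⟨i, w, rfl⟩ := exists_eq_inj' W x
    obtain ⟨j, w', rfl⟩ := exists_eq_inj' W y
    rw [glueFun_inj, glueFun_inj] at h
    have hij : i = j := σ.injective (idx_eq_of_inj_eq W' h)
    subst hij
    rw [(inj_injective W' (σ i)).eq_iff] at h
    rw [(Ψ i).injective h]
  · intro y
    obtain ⟨j, w', rfl⟩ := exists_eq_inj' W' y
    obtain ⟨i, rfl⟩ := σ.surjective j
    exact ⟨inj W i ((Ψ i).symm w'), by rw [glueFun_inj, Diffeomorph.apply_symm_apply]⟩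

/-- **Gluing summand-wise diffeomorphisms along a permutation**: the `C^n` diffeomorphism
`W 0 ⊔ W 1 ⊔ W 2 ≅ W' 0 ⊔ W' 1 ⊔ W' 2` which is `Ψ i : W i ≅ W' (σ i)` on the `i`-th summand (its
inverse is `(Ψ i)⁻¹` on the `σ i`-th summand; smoothness summand by summand,
`contMDiff_of_comp_inj`). [folklore] -/
def glue : TriSum W ≃ₘ^n⟮I, I⟯ TriSum W' where
  toEquiv := Equiv.ofBijective (glueFun σ Ψ) (glueFun_bijective σ Ψ)
  contMDiff_toFun := by
    refine contMDiff_of_comp_inj W fun i => ?_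
    have h : (Equiv.ofBijective (glueFun σ Ψ) (glueFun_bijective σ Ψ)) ∘ inj W i =
        inj W' (σ i) ∘ Ψ i := funext fun w => glueFun_inj σ Ψ i w
    rw [h]
    exact (contMDiff_inj W' (σ i)).comp (Ψ i).contMDiff
  contMDiff_invFun := by
    refine contMDiff_of_comp_inj W' fun j => ?_
    obtain ⟨i, rfl⟩ := σ.surjective j
    have h : (Equiv.ofBijective (glueFun σ Ψ) (glueFun_bijective σ Ψ)).symm ∘ inj W' (σ i) =
        inj W i ∘ (Ψ i).symm := by
      funext w'
      rw [comp_apply, Equiv.symm_apply_eq, Equiv.ofBijective_apply, comp_apply, glueFun_inj,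
        Diffeomorph.apply_symm_apply]
    rw [h]
    exact (contMDiff_inj W i).comp (Ψ i).symm.contMDiff

/-- Defining equation of `glue`: `glue ∘ inj i = inj (σ i) ∘ Ψ i`. [folklore] -/
@[simp]
theorem glue_inj (i : Fin 3) (w : W i) : glue σ Ψ (inj W i w) = inj W' (σ i) (Ψ i w) :=
  glueFun_inj σ Ψ i w

end Glue

/-! #### The boundary datum of a triple disjoint union -/

section Boundary

variable {E H E₀ H₀ : Type*} [NormedAddCommGroup E] [NormedSpace ℝ E] [FiniteDimensional ℝ E]
  [TopologicalSpace H] {I : ModelWithCorners ℝ E H}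
  [NormedAddCommGroup E₀] [NormedSpace ℝ E₀] [FiniteDimensional ℝ E₀] [TopologicalSpace H₀]
  {I₀ : ModelWithCorners ℝ E₀ H₀}
  [∀ i, TopologicalSpace (W i)] [∀ i, ChartedSpace H (W i)] (b : ∀ i, BoundaryData I (W i) I₀)

/-- **The boundary of a disjoint union is the disjoint union of the boundaries**: boundary data
`b i` of the summands `W i` assemble to a boundary datum of `W 0 ⊔ W 1 ⊔ W 2` with carrier
`∂W 0 ⊔ ∂W 1 ⊔ ∂W 2` and inclusion `Sum.map` of the inclusions (a smooth embedding by the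
tree's `Manifold.IsSmoothEmbedding.sumMap`, `BordismProofs.lean`, onto the boundary by Mathlib's
`ModelWithCorners.boundary_disjointUnion`); the triple version of the tree's
`Cobordism.boundaryDataSum`. [folklore] -/
def boundaryData : BoundaryData I (TriSum W) I₀ where
  carrier := TriSum fun i => (b i).carrier
  incl := Sum.map (b 0).incl (Sum.map (b 1).incl (b 2).incl)
  isSmoothEmbedding :=
    (b 0).isSmoothEmbedding.sumMap ((b 1).isSmoothEmbedding.sumMap (b 2).isSmoothEmbedding)
  range_incl := by
    rw [range_sumMap, range_sumMap, ModelWithCorners.boundary_disjointUnion,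
      ModelWithCorners.boundary_disjointUnion, (b 0).range_incl, (b 1).range_incl,
      (b 2).range_incl]

/-- The inclusion of the assembled boundary datum on the `i`-th summand is `inj i ∘ (b i).incl`.
[folklore] -/
@[simp]
theorem boundaryData_incl_inj (i : Fin 3) (z : (b i).carrier) :
    (boundaryData W b).incl (inj (fun i => (b i).carrier) i z) = inj W i ((b i).incl z) := by
  match i with
  | 0 => rfl
  | 1 => rfl
  | 2 => rfl

end Boundary

end TriSum

end Literature.Topology.FourManifolds
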